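import Summits.BirchSwinnertonDyer.BirchSwinnertonDyer.Theorems.ClassRecordThreeEulerHalvesAtThreeCartanTransportResidueMaps
import Summits.BirchSwinnertonDyer.BirchSwinnertonDyer.Theorems.ClassRecordThreeEulerHalvesAtThreeCartanTransportResidueFieldConj
import HarnessLib

/-!
# Cartan transport, brick A1 — the order isomorphism under a conjugation of hulls, transported residue models, the prime 2

Route `ClassRecordThree`, crux `EulerHalvesAtThree` (stmt-19109) ∕ residue crux 23422, line `cartan`, node NUM ⟺ (F2b♮);
workfile `Cruxes/EulerHalvesAtThree/TRANSPORT-HULL.md` (road HT, brick A, step (4)). Helper file, definition-free.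

Setting: two Cartan data `X₁ X₂ : CartanLevelCurveData D M C` and `g ∈ GL₂(ℝ)` conjugating the real images of the HULLS,
`ι₂(X₂.O₀) = g ι₁(X₁.O₀) g⁻¹` elementwise (this is what the tree theorem `CartanDegree.exists_gl_pos_conj` provides for the
Eichler data under `X₁, X₂`, brick H0). Then:
* `ι_injective` — a real embedding of a quaternion algebra over `ℚ` is injective (simple ring);
* `exists_theta` — there is a map `Θ : X₁.B → X₂.B` which on `X₁.O₀` is the ring isomorphism `X₁.O₀ ≅ X₂.O₀` under `g`:
  `ι₂(Θ x) = g ι₁(x) g⁻¹`, additive, multiplicative, unital, `ℤ`-linear, bijective `X₁.O₀ → X₂.O₀`;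
* `isMatrixResidueMap_comp` — for a residue model `ψ : X₂.O₀ → M₂(𝔽_q)` the composite `ψ ∘ Θ` is a residue model of `X₁.O₀`
  (additive, multiplicative, unital, onto, kernel `q X₁.O₀`);
* §2, the prime `2`: `Two.mem_field_two_iff` — `M₂(𝔽₂)` contains ONE copy of `𝔽₄` (`𝔽₂[η] = {0, 1} ∪ {tr = det = 1}` for every `η`
  without rational eigenvalue; an entrywise `decide` over `𝔽₂`), hence `Two.conj_mem_field_iff_two`: every `z ∈ GL₂(𝔽₂)` carries
  `𝔽₂[η']` onto `𝔽₂[η]` — at `q = 2` the conjugating unit of brick A needs no residue prescription (brick S prescribes odd `q` only).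
So the residue descriptions of bricks H2a/H2b apply to `X₁.O` through the models `ψ_q ∘ Θ`, inside the common stage `X₂.O₀`.

HONEST FRAMING: elementary algebra; nothing about NUM, crux 23422 ∕ 19109 or any summit statement is proved by this seat; BSD is
proved for no curve. [folklore]
-/

set_option linter.dupNamespace false
set_option autoImplicit false

noncomputable section

namespace Summit.BirchSwinnertonDyer.BirchSwinnertonDyer.Theorems.CartanTransport.Theta

open Literature.NumberTheory.Automorphic

variable {D M : ℕ} {C : Finset ℕ}

/-- PROVED — **a real embedding `ι : B → M₂(ℝ)` of a quaternion algebra over `ℚ` is injective** (`B` is a simple ring). [folklore] -/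
theorem ι_injective (X : CartanLevelCurveData D M C) : Function.Injective X.ι := by
  haveI := IsQuaternionAlgebra.isSimpleRing' (K := ℚ) (D := X.B)
  exact X.ι.toRingHom.injective

/-- PROVED — cancelling a conjugation: `g m g⁻¹ = g m' g⁻¹ → m = m'`. [folklore] -/
theorem conj_injective (g : GL (Fin 2) ℝ) {m m' : Matrix (Fin 2) (Fin 2) ℝ}
    (h : (g : Matrix (Fin 2) (Fin 2) ℝ) * m * ((g⁻¹ : GL (Fin 2) ℝ) : Matrix (Fin 2) (Fin 2) ℝ) =
      (g : Matrix (Fin 2) (Fin 2) ℝ) * m' * ((g⁻¹ : GL (Fin 2) ℝ) : Matrix (Fin 2) (Fin 2) ℝ)) : m = m' := by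
  have h' := congrArg (fun n => ((g⁻¹ : GL (Fin 2) ℝ) : Matrix (Fin 2) (Fin 2) ℝ) * n * (g : Matrix (Fin 2) (Fin 2) ℝ)) h
  simpa only [← mul_assoc, Units.inv_mul, one_mul, Units.inv_mul_cancel_right] using h'

/-- PROVED — **the order isomorphism under a conjugation of hulls.** If `ι₂(X₂.O₀) = g ι₁(X₁.O₀) g⁻¹` elementwise, there is
`Θ : X₁.B → X₂.B` with, for `x, x' ∈ X₁.O₀`: `Θ x ∈ X₂.O₀`, `ι₂(Θ x) = g ι₁(x) g⁻¹`, `Θ (x + x') = Θ x + Θ x'`, `Θ (x x') = Θ x Θ x'`,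
`Θ 1 = 1`, `Θ (n • x) = n • Θ x`, every `y ∈ X₂.O₀` is some `Θ x`, and `Θ` is injective on `X₁.O₀`. (Values off `X₁.O₀` are junk.) [folklore] -/
theorem exists_theta (X₁ X₂ : CartanLevelCurveData D M C) (g : GL (Fin 2) ℝ)
    (H : ∀ m : Matrix (Fin 2) (Fin 2) ℝ, (∃ x ∈ X₁.O₀, X₁.ι x = m) ↔
      ∃ y ∈ X₂.O₀, X₂.ι y = (g : Matrix (Fin 2) (Fin 2) ℝ) * m * ((g⁻¹ : GL (Fin 2) ℝ) : Matrix (Fin 2) (Fin 2) ℝ)) :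
    ∃ Θ : X₁.B → X₂.B,
      (∀ x ∈ X₁.O₀, Θ x ∈ X₂.O₀) ∧
      (∀ x ∈ X₁.O₀, X₂.ι (Θ x) = (g : Matrix (Fin 2) (Fin 2) ℝ) * X₁.ι x * ((g⁻¹ : GL (Fin 2) ℝ) : Matrix (Fin 2) (Fin 2) ℝ)) ∧
      (∀ x ∈ X₁.O₀, ∀ x' ∈ X₁.O₀, Θ (x + x') = Θ x + Θ x') ∧
      (∀ x ∈ X₁.O₀, ∀ x' ∈ X₁.O₀, Θ (x * x') = Θ x * Θ x') ∧
      Θ 1 = 1 ∧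
      (∀ x ∈ X₁.O₀, ∀ n : ℤ, Θ (n • x) = n • Θ x) ∧
      (∀ y ∈ X₂.O₀, ∃ x ∈ X₁.O₀, Θ x = y) ∧
      (∀ x ∈ X₁.O₀, ∀ x' ∈ X₁.O₀, Θ x = Θ x' → x = x') := by
  classical
  have hO₁ : Brandt.IsOrder X₁.B X₁.O₀ := X₁.isEichlerOrder.isOrder
  have hfwd : ∀ x ∈ X₁.O₀, ∃ y ∈ X₂.O₀, X₂.ι y = (g : Matrix (Fin 2) (Fin 2) ℝ) * X₁.ι x * ((g⁻¹ : GL (Fin 2) ℝ) : Matrix (Fin 2) (Fin 2) ℝ) :=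
    fun x hx => (H _).mp ⟨x, hx, rfl⟩
  choose Θd hΘdO hΘdι using hfwd
  set Θ : X₁.B → X₂.B := fun x => if hx : x ∈ X₁.O₀ then Θd x hx else 0 with hΘ
  have hΘd : ∀ x (hx : x ∈ X₁.O₀), Θ x = Θd x hx := fun x hx => by simp only [hΘ, dif_pos hx]
  have hΘO : ∀ x ∈ X₁.O₀, Θ x ∈ X₂.O₀ := fun x hx => by rw [hΘd x hx]; exact hΘdO x hx
  have hΘι : ∀ x ∈ X₁.O₀, X₂.ι (Θ x) = (g : Matrix (Fin 2) (Fin 2) ℝ) * X₁.ι x * ((g⁻¹ : GL (Fin 2) ℝ) : Matrix (Fin 2) (Fin 2) ℝ) := fun x hx => by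
    rw [hΘd x hx]; exact hΘdι x hx
  -- uniqueness of the partner
  have huniq : ∀ x ∈ X₁.O₀, ∀ y : X₂.B,
      X₂.ι y = (g : Matrix (Fin 2) (Fin 2) ℝ) * X₁.ι x * ((g⁻¹ : GL (Fin 2) ℝ) : Matrix (Fin 2) (Fin 2) ℝ) → y = Θ x :=
    fun x hx y hy => ι_injective X₂ (by rw [hy, hΘι x hx])
  have hgg : ((g⁻¹ : GL (Fin 2) ℝ) : Matrix (Fin 2) (Fin 2) ℝ) * (g : Matrix (Fin 2) (Fin 2) ℝ) = 1 := Units.inv_mul g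
  refine ⟨Θ, hΘO, hΘι, ?_, ?_, ?_, ?_, ?_, ?_⟩
  · intro x hx x' hx'
    refine (huniq _ (X₁.O₀.add_mem hx hx') _ ?_).symm
    rw [map_add, hΘι x hx, hΘι x' hx', map_add, mul_add, add_mul]
  · intro x hx x' hx'
    refine (huniq _ (hO₁.mul_mem x hx x' hx') _ ?_).symm
    rw [map_mul, hΘι x hx, hΘι x' hx', map_mul]
    simp only [mul_assoc]
    rw [← mul_assoc (((g⁻¹ : GL (Fin 2) ℝ) : Matrix (Fin 2) (Fin 2) ℝ)) (g : Matrix (Fin 2) (Fin 2) ℝ), hgg, one_mul]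
  · refine (huniq 1 hO₁.one_mem 1 ?_).symm
    rw [map_one, map_one, mul_one, Units.mul_inv]
  · intro x hx n
    refine (huniq _ (X₁.O₀.smul_mem n hx) _ ?_).symm
    rw [map_zsmul, hΘι x hx, map_zsmul, Matrix.mul_smul, Matrix.smul_mul]
  · intro y hy
    obtain ⟨x, hx, hxι⟩ := (H (((g⁻¹ : GL (Fin 2) ℝ) : Matrix (Fin 2) (Fin 2) ℝ) * X₂.ι y * (g : Matrix (Fin 2) (Fin 2) ℝ))).mpr
      ⟨y, hy, by simp only [← mul_assoc, Units.mul_inv, one_mul, Units.mul_inv_cancel_right]⟩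
    refine ⟨x, hx, (huniq x hx y ?_).symm⟩
    rw [hxι]
    simp only [← mul_assoc, Units.mul_inv, one_mul, Units.mul_inv_cancel_right]
  · intro x hx x' hx' he
    refine ι_injective X₁ (conj_injective g ?_)
    rw [← hΘι x hx, ← hΘι x' hx', he]

/-- PROVED — **transported residue models**: for `Θ` as in `exists_theta` (order isomorphism `X₁.O₀ ≅ X₂.O₀`) and a residue model
`ψ` of `X₂.O₀` modulo `q`, the composite `ψ ∘ Θ` is a residue model of `X₁.O₀` modulo `q`. [folklore] -/
theorem isMatrixResidueMap_comp (X₁ X₂ : CartanLevelCurveData D M C) {Θ : X₁.B → X₂.B}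
    (hΘO : ∀ x ∈ X₁.O₀, Θ x ∈ X₂.O₀)
    (hadd : ∀ x ∈ X₁.O₀, ∀ x' ∈ X₁.O₀, Θ (x + x') = Θ x + Θ x')
    (hmul : ∀ x ∈ X₁.O₀, ∀ x' ∈ X₁.O₀, Θ (x * x') = Θ x * Θ x')
    (hone : Θ 1 = 1)
    (hsmul : ∀ x ∈ X₁.O₀, ∀ n : ℤ, Θ (n • x) = n • Θ x)
    (hsurj : ∀ y ∈ X₂.O₀, ∃ x ∈ X₁.O₀, Θ x = y)
    (hinj : ∀ x ∈ X₁.O₀, ∀ x' ∈ X₁.O₀, Θ x = Θ x' → x = x')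
    {q : ℕ} [Fact q.Prime] {ψ : X₂.B → Matrix (Fin 2) (Fin 2) (ZMod q)} (h : IsMatrixResidueMap X₂.O₀ q ψ) :
    IsMatrixResidueMap X₁.O₀ q (fun x => ψ (Θ x)) where
  map_add x hx y hy := by
    rw [hadd x hx y hy, h.map_add _ (hΘO x hx) _ (hΘO y hy)]
  map_mul x hx y hy := by
    rw [hmul x hx y hy, h.map_mul _ (hΘO x hx) _ (hΘO y hy)]
  map_one := by rw [hone, h.map_one]
  surj m := by
    obtain ⟨y, hy, hψy⟩ := h.surj m
    obtain ⟨x, hx, hΘx⟩ := hsurj y hy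
    exact ⟨x, hx, by rw [hΘx, hψy]⟩
  ker x hx := by
    constructor
    · intro h0
      obtain ⟨y', hy', hΘx⟩ := (h.ker _ (hΘO x hx)).mp h0
      obtain ⟨z, hz, hΘz⟩ := hsurj y' hy'
      refine ⟨z, hz, hinj x hx _ (X₁.O₀.smul_mem _ hz) ?_⟩
      rw [hsmul z hz, hΘz, hΘx]
    · rintro ⟨z, hz, rfl⟩
      rw [hsmul z hz]
      exact h.map_smul_eq_zero (hΘO z hz)

end Summit.BirchSwinnertonDyer.BirchSwinnertonDyer.Theorems.CartanTransport.Theta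

/-! ## §2 The prime `2`: `M₂(𝔽₂)` has a single subfield `𝔽₄` -/

namespace Summit.BirchSwinnertonDyer.BirchSwinnertonDyer.Theorems.CartanTransport.Two

open Summit.BirchSwinnertonDyer.BirchSwinnertonDyer.Theorems.CartanDegree
open Summit.BirchSwinnertonDyer.BirchSwinnertonDyer.Theorems.CartanTorusCubeCut
open Summit.BirchSwinnertonDyer.BirchSwinnertonDyer.Theorems.CartanTransport


set_option synthInstance.maxSize 1024 in
set_option synthInstance.maxHeartbeats 200000 in
/-- PROVED: the entrywise heart over `𝔽₂` (256 assignments): for `η = (e₁ e₂; e₃ e₄)` with trace `1` and determinant `1`, a matrix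
`m = (m₁ m₂; m₃ m₄)` is of the form `a·1 + b·η` iff `m ∈ {0, 1}` or `tr m = det m = 1`. [folklore] -/
theorem zmod_two_field : ∀ e₁ e₂ e₃ e₄ : ZMod 2, e₁ + e₄ = 1 → e₁ * e₄ - e₂ * e₃ = 1 → ∀ m₁ m₂ m₃ m₄ : ZMod 2,
    ((∃ a b : ZMod 2, m₁ = a + b * e₁ ∧ m₂ = b * e₂ ∧ m₃ = b * e₃ ∧ m₄ = a + b * e₄) ↔
      ((m₁ = 0 ∧ m₂ = 0 ∧ m₃ = 0 ∧ m₄ = 0) ∨ (m₁ = 1 ∧ m₂ = 0 ∧ m₃ = 0 ∧ m₄ = 1) ∨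
        (m₁ + m₄ = 1 ∧ m₁ * m₄ - m₂ * m₃ = 1))) := by
  decide

/-- PROVED — **`M₂(𝔽₂)` contains a single copy of `𝔽₄`**: for `η` without rational eigenvalue over `𝔽₂`, `m ∈ 𝔽₂[η]` iff `m = 0`, `m = 1`,
or `tr m = det m = 1` — a description not mentioning `η`. [folklore] -/
theorem mem_field_two_iff {η : Mat 2} (hη : ¬ HasRatEigenvalue η) (m : Mat 2) :
    (∃ p : ZMod 2 × ZMod 2, m = lin η p) ↔ (m = 0 ∨ m = 1 ∨ (m.trace = 1 ∧ m.det = 1)) := by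
  obtain ⟨htr, hdet⟩ := ResidueField.trace_det_of_two rfl hη
  rw [Matrix.trace_fin_two] at htr
  rw [Matrix.det_fin_two] at hdet
  have key := zmod_two_field (η 0 0) (η 0 1) (η 1 0) (η 1 1) htr hdet (m 0 0) (m 0 1) (m 1 0) (m 1 1)
  have hlin : ∀ p : ZMod 2 × ZMod 2, m = lin η p ↔
      (m 0 0 = p.1 + p.2 * η 0 0 ∧ m 0 1 = p.2 * η 0 1 ∧ m 1 0 = p.2 * η 1 0 ∧ m 1 1 = p.1 + p.2 * η 1 1) := by
    intro p
    rw [← Matrix.ext_iff]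
    simp only [lin, Matrix.add_apply, Matrix.smul_apply, Matrix.one_apply, smul_eq_mul, Fin.forall_fin_two, Fin.isValue,
      if_true, one_ne_zero, zero_ne_one, if_false, mul_one, mul_zero, zero_add]
    tauto
  have h0 : m = 0 ↔ (m 0 0 = 0 ∧ m 0 1 = 0 ∧ m 1 0 = 0 ∧ m 1 1 = 0) := by
    rw [← Matrix.ext_iff]
    simp only [Matrix.zero_apply, Fin.forall_fin_two, Fin.isValue]
    tauto
  have h1 : m = 1 ↔ (m 0 0 = 1 ∧ m 0 1 = 0 ∧ m 1 0 = 0 ∧ m 1 1 = 1) := by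
    rw [← Matrix.ext_iff]
    simp only [Matrix.one_apply, Fin.forall_fin_two, Fin.isValue, if_true, one_ne_zero, zero_ne_one, if_false]
    tauto
  rw [h0, h1, Matrix.trace_fin_two, Matrix.det_fin_two, ← key]
  constructor
  · rintro ⟨p, hp⟩
    exact ⟨p.1, p.2, (hlin p).mp hp⟩
  · rintro ⟨a, b, h⟩
    exact ⟨(a, b), (hlin (a, b)).mpr h⟩

/-- PROVED — **at `q = 2` every unit normalises the residue field**: for `η, η'` without rational eigenvalue over `𝔽₂` and ANY
`z ∈ GL₂(𝔽₂)`, `m ∈ 𝔽₂[η']` iff `z⁻¹ m z ∈ 𝔽₂[η]` (both fields are THE copy of `𝔽₄`, stable under conjugation). [folklore] -/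
theorem conj_mem_field_iff_two {η η' : Mat 2} (hη : ¬ HasRatEigenvalue η) (hη' : ¬ HasRatEigenvalue η') (z : G 2) (m : Mat 2) :
    (∃ p : ZMod 2 × ZMod 2, m = lin η' p) ↔
      ∃ p' : ZMod 2 × ZMod 2, ((z⁻¹ : G 2) : Mat 2) * m * (z : Mat 2) = lin η p' := by
  rw [mem_field_two_iff hη' m]
  conv_rhs => rw [show (∃ p' : ZMod 2 × ZMod 2, ((z⁻¹ : G 2) : Mat 2) * m * (z : Mat 2) = lin η p') ↔ _ from
    mem_field_two_iff hη _]
  rw [Matrix.trace_units_conj', Matrix.det_units_conj']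
  have hz0 : ((z⁻¹ : G 2) : Mat 2) * m * (z : Mat 2) = 0 ↔ m = 0 := by
    constructor
    · intro h
      have h' := congrArg (fun n => (z : Mat 2) * n * ((z⁻¹ : G 2) : Mat 2)) h
      simpa only [← mul_assoc, Units.mul_inv, one_mul, Units.mul_inv_cancel_right, mul_zero, zero_mul] using h'
    · rintro rfl
      rw [mul_zero, zero_mul]
  have hz1 : ((z⁻¹ : G 2) : Mat 2) * m * (z : Mat 2) = 1 ↔ m = 1 := by
    constructor
    · intro h
      have h' := congrArg (fun n => (z : Mat 2) * n * ((z⁻¹ : G 2) : Mat 2)) h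
      simpa only [← mul_assoc, Units.mul_inv, one_mul, Units.mul_inv_cancel_right, mul_one] using h'
    · rintro rfl
      rw [mul_one, Units.inv_mul]
  rw [hz0, hz1]

end Summit.BirchSwinnertonDyer.BirchSwinnertonDyer.Theorems.CartanTransport.Two
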